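import Literature.NumberTheory.LFunctions.Zhang2022.Section8Step8u014
import Literature.NumberTheory.LFunctions.Zhang2022.Section3Lemma33

/-!
# Route `ZDegreeToeplitzBand`, crux `PsiGradedTablesClosePoly` (stmt-Parity-22438), line `long_poly_dil`, stub
# `stub_lemma81LongPsiDil` (P2-Dil): Part 9 — Z22:§8.u014 AT TWO TRUNCATIONS REDUCED TO THE COEFFICIENT CONVOLUTION:
# `Σ_{Ψ₁}|A_{N₁}(a₁;s)A_{N₂}(a₂;1−s,ψ̄)|² ≤ C·P²·Σ_{m≤P²}|c_m|²m^{−2σ}`, `c = a₁ ⋆ (ā₂·n^{2σ−1})`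

Y. Zhang, *Discrete mean estimates and the Landau–Siegel zero*, arXiv:2211.02515v1 — an unrefereed manuscript under
adjudication. **The programme SEARCHES and TYPES; no claim about Landau–Siegel zeros, Theorems 1–2 of arXiv:2211.02515
or a repaired Margin232 until a kernel theorem says so.**

The printed u014 squares each polynomial (`|A₁A₂|² ≤ ½(|A₁|⁴+|A₂|⁴)`, `Ded81Edge.step8u014_body`); for a LONG ψ-side
polynomial (`N₁² > P²`) that route is closed, but the PRODUCT `A_{N₁}(a₁;s,ψ)·A_{N₂}(ā₂;s̄′,ψ)` (`s̄′ = conj(1−s)`; the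
`ψ̄`-factor is a `ψ`-polynomial at the reflected point, `Ded81Edge.norm_dirPoly_inv_eq`) is ONE Dirichlet polynomial in
`ψ` of length `(N₁−1)(N₂−1)` with coefficients `c_m = Σ_{kn=m} a₁(k)ā₂(n)n^{s−s̄′}` (`s − s̄′ = 2σ − 1`, real), to which
Lemma 3.3 (ii) (`Skeleton.lemma33b_sum_le`, length `⌊P²⌋`) applies whenever `(N₁−1)(N₂−1) ≤ ⌊P²⌋`
(`lemma81Ext_dirPoly_mul_dirPoly_eq`, `lemma81Ext_meanSq_le`; supports shrink the truncations first,
`lemma81Ext_dirPoly_support_trunc`). This is the interface the residual stub of P2-Dil (the `o(D·P²𝓛³⁸)` coefficient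
mean square for the cell heads, budget memo BUDGET-P2Dil-g20.md on stmt-Parity-22438) plugs into. Theorems only; no
definitions; no new named facts. Prover: ls-knife-typer-3 g20 (cell landau-siegel §D), `--supports` stmt-Parity-22438.
[cite: Zhang2022LandauSiegel, §8 p. 43, tex L2248–2250; §3 Lemma 3.3 (ii)]
-/

noncomputable section

open Complex Real ComplexConjugate Finset
open Literature.NumberTheory.LFunctions.Zhang2022
open Literature.NumberTheory.LFunctions.Zhang2022.Skeleton

namespace Summit.Parity.GeneralizedHardyLittlewood.Theorems

/-! ### The product of two Dirichlet polynomials at two points is one Dirichlet polynomial -/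

/-- **`A_{N₁}(a;s,θ)·A_{N₂}(b;w,θ) = Σ_{1≤m≤K} c_m θ(m)m^{−s}`**, `c_m = Σ_{kn=m, k<N₁, n<N₂} a(k)b(n)n^{s−w}`, for any
`K ≥ (N₁−1)(N₂−1)` (the `k = 0`, `n = 0` terms vanish, `θ(0) = 0` for a modulus `≠ 1`; `n^{−w} = n^{s−w}·n^{−s}`,
`k^{−s}n^{−s} = (kn)^{−s}`). [cite: Zhang2022LandauSiegel, §8 p. 43; §3 Lemma 3.3] -/
theorem lemma81Ext_dirPoly_mul_dirPoly_eq {q : ℕ} [NeZero q] (hq : q ≠ 1) (N₁ N₂ : ℕ) (a b : ℕ → ℂ)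
    (θ : DirichletCharacter ℂ q) (s w : ℂ) {K : ℕ} (hK : (N₁ - 1) * (N₂ - 1) ≤ K) :
    Lemma81.dirPoly N₁ a θ s * Lemma81.dirPoly N₂ b θ w =
      ∑ m ∈ Icc 1 K,
        (∑ p ∈ (Ico 1 N₁ ×ˢ Ico 1 N₂).filter (fun p => p.1 * p.2 = m),
            a p.1 * b p.2 * (p.2 : ℂ) ^ (s - w)) * θ m * (m : ℂ) ^ (-s) := by
  have hmaps : ∀ p ∈ Ico 1 N₁ ×ˢ Ico 1 N₂, p.1 * p.2 ∈ Icc 1 K := by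
    intro p hp
    rw [Finset.mem_product, Finset.mem_Ico, Finset.mem_Ico] at hp
    rw [Finset.mem_Icc]
    refine ⟨Nat.one_le_iff_ne_zero.mpr (Nat.mul_ne_zero (by omega) (by omega)), ?_⟩
    calc p.1 * p.2 ≤ (N₁ - 1) * (N₂ - 1) := Nat.mul_le_mul (by omega) (by omega)
      _ ≤ K := hK
  rw [Ded81Edge.dirPoly_eq_sum_Ico N₁ a θ hq, Ded81Edge.dirPoly_eq_sum_Ico N₂ b θ hq, Finset.sum_mul_sum,
    ← Finset.sum_product']
  rw [← Finset.sum_fiberwise_of_maps_to hmaps]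
  refine Finset.sum_congr rfl fun m _ => ?_
  rw [Finset.sum_mul, Finset.sum_mul]
  refine Finset.sum_congr rfl fun p hp => ?_
  obtain ⟨hp', hpm⟩ := Finset.mem_filter.mp hp
  rw [Finset.mem_product, Finset.mem_Ico, Finset.mem_Ico] at hp'
  have hn0 : (p.2 : ℂ) ≠ 0 := by exact_mod_cast (show p.2 ≠ 0 by omega)
  have hsplit : (p.2 : ℂ) ^ (-w) = (p.2 : ℂ) ^ (s - w) * (p.2 : ℂ) ^ (-s) := by
    rw [← Complex.cpow_add _ _ hn0]; ring_nf
  have h1 : θ ((p.1 * p.2 : ℕ) : ZMod q) = θ (p.1 : ZMod q) * θ (p.2 : ZMod q) := by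
    rw [Nat.cast_mul, map_mul]
  have h2 : ((p.1 * p.2 : ℕ) : ℂ) ^ (-s) = (p.1 : ℂ) ^ (-s) * (p.2 : ℂ) ^ (-s) := by
    rw [Nat.cast_mul, Complex.natCast_mul_natCast_cpow]
  rw [← hpm, hsplit, h1, h2]
  ring

/-- **Shrinking a truncation to the support**: if `a(n) = 0` for `n > M` then `A_N(a;·,θ) = A_{min(N, M+1)}(a;·,θ)`.
[cite: Zhang2022LandauSiegel, §7 (7.2) p. 13] -/
theorem lemma81Ext_dirPoly_support_trunc {q : ℕ} (N M : ℕ) {a : ℕ → ℂ} (ha : ∀ n, M < n → a n = 0)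
    (θ : DirichletCharacter ℂ q) (w : ℂ) :
    Lemma81.dirPoly N a θ w = Lemma81.dirPoly (min N (M + 1)) a θ w := by
  rw [Lemma81.dirPoly_def, Lemma81.dirPoly_def]
  symm
  refine Finset.sum_subset (fun n hn => ?_) (fun n hn hn' => ?_)
  · rw [Finset.mem_range] at hn ⊢
    exact lt_of_lt_of_le hn (min_le_left _ _)
  · rw [Finset.mem_range] at hn hn'
    have hMn : M < n := by
      by_contra h
      exact hn' (lt_min hn (by omega))
    rw [ha n hMn, zero_mul, zero_mul]

/-! ### Z22:§8.u014 at two truncations, as a coefficient mean square -/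

/-- The `ψ̄`-factor of the cross product is the `ψ`-polynomial of the conjugate data at the reflected point, so that
`|A_{N₁}(a₁;s,ψ)A_{N₂}(a₂;1−s,ψ̄)| = |A_{N₁}(a₁;s,ψ)·A_{N₂}(ā₂;conj(1−s),ψ)|`. [cite: Zhang2022LandauSiegel, §8 p. 43] -/
theorem lemma81Ext_norm_cross_eq {q : ℕ} [NeZero q] (N₁ N₂ : ℕ) (a₁ a₂ : ℕ → ℂ) (θ : DirichletCharacter ℂ q) (s : ℂ) :
    ‖Lemma81.dirPoly N₁ a₁ θ s * Lemma81.dirPoly N₂ a₂ θ⁻¹ (1 - s)‖ =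
      ‖Lemma81.dirPoly N₁ a₁ θ s * Lemma81.dirPoly N₂ (fun n => conj (a₂ n)) θ (conj (1 - s))‖ := by
  rw [norm_mul, norm_mul, Ded81Edge.norm_dirPoly_inv_eq]

/-- **Z22:§8.u014 AT TWO TRUNCATIONS, REDUCED TO THE COEFFICIENTS** (Lemma 3.3 (ii) on the ONE product polynomial): for
every modulus datum, every finite family `T ⊆ Ψ` (e.g. `finsetOf (PsiOne χ)`), all truncations with
`(N₁−1)(N₂−1) ≤ ⌊P²⌋`, all coefficients and every `s`,
`Σ_{ψ∈T} |A_{N₁}(a₁;s,ψ)A_{N₂}(a₂;1−s,ψ̄)|² ≤ C₃₃·P²·Σ_{m≤⌊P²⌋} |c_m|²·m^{−2Re s}` with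
`c_m = Σ_{kn=m, k<N₁, n<N₂} a₁(k)·conj(a₂(n))·n^{s − conj(1−s)}` (`s − conj(1−s) = 2Re s − 1`, real) and
`C₃₃ = 2 + 2(3 + (log 2)⁻⁶⁸)²` (`Skeleton.lemma33b_sum_le`). No (7.2), no (A).
[cite: Zhang2022LandauSiegel, §8 p. 43, tex L2248–2250; §3 Lemma 3.3 (ii)] -/
theorem lemma81Ext_meanSq_le {D : ℕ} (T : Finset (Chr D)) (N₁ N₂ : ℕ) (a₁ a₂ : ℕ → ℂ) (s : ℂ)
    (hK : (N₁ - 1) * (N₂ - 1) ≤ ⌊bigP D ^ 2⌋₊) :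
    ∑ x ∈ T, ‖Lemma81.dirPoly N₁ a₁ x.ψ s * Lemma81.dirPoly N₂ a₂ x.ψ⁻¹ (1 - s)‖ ^ 2 ≤
      (2 + 2 * (3 + (Real.log 2 ^ 68)⁻¹) ^ 2) * bigP D ^ 2 *
        ∑ m ∈ Icc 1 ⌊bigP D ^ 2⌋₊,
          ‖∑ p ∈ (Ico 1 N₁ ×ˢ Ico 1 N₂).filter (fun p => p.1 * p.2 = m),
              a₁ p.1 * conj (a₂ p.2) * (p.2 : ℂ) ^ (s - conj (1 - s))‖ ^ 2 * (m : ℝ) ^ (-2 * s.re) := by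
  have hterm : ∀ x ∈ T, ‖Lemma81.dirPoly N₁ a₁ x.ψ s * Lemma81.dirPoly N₂ a₂ x.ψ⁻¹ (1 - s)‖ ^ 2 =
      ‖∑ m ∈ Icc 1 ⌊bigP D ^ 2⌋₊,
        (∑ p ∈ (Ico 1 N₁ ×ˢ Ico 1 N₂).filter (fun p => p.1 * p.2 = m),
            a₁ p.1 * conj (a₂ p.2) * (p.2 : ℂ) ^ (s - conj (1 - s))) * x.ψ (m : ZMod x.p) * (m : ℂ) ^ (-s)‖ ^ 2 := by
    intro x _
    rw [lemma81Ext_norm_cross_eq, lemma81Ext_dirPoly_mul_dirPoly_eq x.p_ne_one N₁ N₂ a₁ _ x.ψ s _ hK]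
  rw [Finset.sum_congr rfl hterm]
  exact lemma33b_sum_le T s _

/-- The coefficients in absolute value: `|c_m| ≤ Σ_{kn=m} |a₁(k)||a₂(n)|·n^{2Re s − 1}` (`|n^{s−conj(1−s)}| = n^{2σ−1}`).
[cite: Zhang2022LandauSiegel, §8 p. 43] -/
theorem lemma81Ext_norm_coeff_le (N₁ N₂ : ℕ) (a₁ a₂ : ℕ → ℂ) (s : ℂ) (m : ℕ) :
    ‖∑ p ∈ (Ico 1 N₁ ×ˢ Ico 1 N₂).filter (fun p => p.1 * p.2 = m),
        a₁ p.1 * conj (a₂ p.2) * (p.2 : ℂ) ^ (s - conj (1 - s))‖ ≤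
      ∑ p ∈ (Ico 1 N₁ ×ˢ Ico 1 N₂).filter (fun p => p.1 * p.2 = m),
        ‖a₁ p.1‖ * ‖a₂ p.2‖ * (p.2 : ℝ) ^ (2 * s.re - 1) := by
  refine (norm_sum_le _ _).trans (Finset.sum_le_sum fun p hp => ?_)
  obtain ⟨hp', -⟩ := Finset.mem_filter.mp hp
  rw [Finset.mem_product, Finset.mem_Ico, Finset.mem_Ico] at hp'
  have hn : 0 < p.2 := by omega
  rw [norm_mul, norm_mul, Complex.norm_conj, Complex.norm_natCast_cpow_of_pos hn]
  have hre : (s - conj (1 - s)).re = 2 * s.re - 1 := by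
    simp only [Complex.sub_re, Complex.conj_re, Complex.one_re]; ring
  rw [hre]

end Summit.Parity.GeneralizedHardyLittlewood.Theorems

end
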